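import Mathlib
import HarnessLib
import HarnessLib.Audit
import Summits.NavierStokesRegularity.Statement
import Literature.Analysis.FluidPDE.ClassicalSolution
import Literature.Analysis.FluidPDE.LerayHopf
import Literature.Analysis.FluidPDE.NSWave0
import Literature.Analysis.FluidPDE.SelfSimilar
import Literature.Analysis.FluidPDE.LocalTypeI
import Literature.Analysis.FluidPDE.VectorCalculus
import Literature.Analysis.FluidPDE.SereginSverak2002PressureLowerBound
import Literature.Analysis.FluidPDE.NSBoundedMildOseen
import Literature.Analysis.FluidPDE.PressureRepresentation
import Literature.Analysis.UnboundedOperators.HeatKernel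
import HarnessLib.Audit.Status.Attr

/-!
Route: LocalPressureProfileDoor

CLOSED (proved) 2026-08-27T18:26:41Z by planner-director-ns-g8-0 — reason: proved:Summit.NavierStokesRegularity.NavierStokesRegularity.Theorems.LocalPressureProfileDoorTargetClose.target_proof — note: D-0092 director verb (route opened by director-ns g7; successor g8 closes): rung-leaf N0-LocalTubeDoorPressureProfile CLOSED·PROVED — all four items closed proved (20179 Target by p554679 target_proof; 20180 K2⁺ p550500; 20181 K1; 20182 Assembly); CONDITIONAL door (local Type I + shift-monotone simi. The file is kept as the record of this route; refuted decls are indexed as negative knowledge (`ledger negatives`).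

# Route LocalPressureProfileDoor — space–time Type I plus an asymptotically NON-INCREASING
similarity pressure forces regularity — the eternal head-pressure budget

RUNG-LEAF ROUTE (D-0061; leaf = the proposed rung N0-LocalTubeDoorPressureProfile of LADDER-NS =
this route's own `Target` item, the ONE-SIDED PRESSURE-PROFILE DOOR S17⁺ of cell nsreg-p1 ROUND-16;
it does NOT claim Clay (A)). It suffices to show X = K1 ∧ K2⁺: (K1
`LocalPointZoomSimilarityPressure`) at a point that is locally space–time Type I but not backward
bounded, the tree's parabolic point zoom converges — together with the gauge-free Riesz pressure
`Q[u] = pressurePotential u` read in similarity variables `(T−t)·Q[u(t)](x₀+√(T−t)y)` — to a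
door-class profile `v` that is backward-singular at the apex; (K2⁺
`MonotonePressureProfileRigidity`, THE crux, not in print) a door-class profile (Type I in time,
space–time Type-I decay, continuous, unit-viscosity Oseen-mild, divergence-free) whose similarity
pressure `(−t)·Q[v(t)](√(−t)y)` is non-increasing in `t` (stated through the shifts `t ↦ e^(−σ)t`,
`σ ∈ [0,1]`) is NOT backward-singular at the apex. The door follows by reading its hypothesis along
the zoom (deciding theorem `closes`, logic + limits, certified).
Lean:
`Summit.NavierStokesRegularity.NavierStokesRegularity.Theses.LocalPressureProfileDoor.LocalPointZoomSimilarityPressure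
∧
Summit.NavierStokesRegularity.NavierStokesRegularity.Theses.LocalPressureProfileDoor.MonotonePressureProfileRigidity`

## Assembly
The deciding theorem `closes (h₁ : LocalPointZoomSimilarityPressure) (h₂ :
MonotonePressureProfileRigidity) : Target` (glue.lean; ≈ 40 lines of logic and limits, certified by
`ledger route check --native`): assume the leaf's hypotheses and ¬ backward bounded; K1 gives C, D,
v, λⱼ with the door class, the singular apex and the similarity-pressure convergence; for fixed t <
0, σ ∈ [0,1], y, the zoom times tⱼ = T + λⱼ²t/ν tend to T from below, the door hypothesis at
similarity position √ν·y with tolerance ν·ε holds eventually along them, the shifted zoom time T −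
e^(−σ)(T − tⱼ) IS the zoom time of e^(−σ)t (one `ring`), so dividing by ν and passing to the limit
(le_of_tendsto) gives P_v(e^(−σ)t, y) − P_v(t, y) ≤ ε for every ε > 0, i.e. the hypothesis of K2⁺;
K2⁺ contradicts the singular apex. BOTH binders are consumed. The cell sketch r16/Sketch17.lean also
kernel-checks the sibling identity door S17 (shift-invariant similarity pressure GRADIENT on one
window) from K1's gradient clause + two supports (PressureWindowToSlab,
SteadyGradientSteadyPressure) + K2⁺; that leaf is not filed here (one thesis, cone 2).

CLOSES_TARGET: closes rung N0-LocalTubeDoorPressureProfile of NavierStokesRegularity: Summit.NavierStokesRegularity.NavierStokesRegularity.Theses.LocalPressureProfileDoor.Target (D-0061; not the summit Statement) — the deciding theorem of this route concludes that registered leaf instead of the Statement decl `NavierStokesRegularity` (class rung: servable and labelled, never counted as concluding the summit Statement).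

Rationale: WHY THIS LINE. The cell's doors so far read LOCAL observables of the VELOCITY GRADIENT on similarity
windows (direction, one component, helicity density, strain spectrum); this is the first PRESSURE
member and the first one-sided member with a complete proof plan for its profile crux. Mechanism
(PineauVicol2026 §4–5 made parabolic; Tsai1998 / NecasRuzickaSverak1996 for the steady rung): in
Leray variables the head pressure `Π = P + ½|U|² + ½y·U` of an ETERNAL profile obeys `∂ₛΠ + LΠ =
−|Ω|² + ∂ₛP` with `L = −Δ + (U+½y)·∇` — the tree's `driftOp_headPressure_forced` with forcing `F =
∂ₛU`, whose `F`-terms cancel exactly against `∂ₛΠ − ∂ₛP = (U+½y)·∂ₛU` — so against a positive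
unit-mass solution `w` of the ADJOINT parabolic equation `∂ₛw + Δw + div((U+½y)w) = 0` one gets the
budget `∫∫ w|Ω|² dy ds = [∫wΠ] + ∫∫ w ∂ₛP ≤ 2 sup|Π|` whenever `∂ₛP ≤ 0`; a uniform floor `w ≥
c(D,R)` on balls (tightness of the inward Ornstein–Uhlenbeck-type law + the tree's parabolic Harnack
inequality Lieberman1996 Thm 6.27, `Lieberman1996_harnack_drift_gap_holds`) makes the local
enstrophy integrable over the infinite past, hence small on far-past slices, and backward
scaling-invariance moves such a slice to where the tree's PROVED propagation of small vorticity
(`pineauVicol_smallVorticity_propagation`, PineauVicol2026 Lemma 9.4) and the CKN tail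
(`exists_cknE_le_of_core_small`, `pineauVicol_regular_of_zoom_small`, CaffarelliKohnNirenberg1982)
give a regular apex. Imported from stochastic analysis / linear parabolic theory: the adjoint
(Fokker–Planck) weight and its Harnack floor; from PineauVicol2026: similarity-variables head
pressure and pointwise pressure decay. What it does that prior routes and the negatives index do
not: AffineBernoulli / BernoulliDeceleration / HiddenConvexityPressureFloor / RellichScar use the
head or the pressure in PHYSICAL variables on slabs or scars (no similarity variables, no adjoint
weight, no profile Liouville); no refuted statement of the summit (OddMorawetz 1376,
SymmetryModuliCount 4055, PerpetualPump 1832, AdiabaticEddy 1429, Blowup 0154) concerns pressure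
monotonicity or profile rigidity.

RANKED CRUXES. #0 Target (target) — the leaf (door S17⁺): a classical NS solution on [0,T),
Leray–Hopf from a rapidly decaying datum, locally SPACE–TIME Type I at (x₀,T)
(‖u(t,x)‖(‖x−x₀‖+√(ν(T−t))) ≤ M on B(x₀,ρ) × (T−ρ²,T)), whose similarity Riesz pressure P(t,y) =
(T−t)·Q[u(t)](x₀+√(T−t)y) is ASYMPTOTICALLY NON-INCREASING in similarity time — for every shift σ ∈
[0,1], every similarity position y and every ε > 0, eventually as t ↑ T, P(T − e^(−σ)(T−t), y) −
P(t, y) ≤ ε — is backward bounded at x₀ (u stays bounded on some B(x₀,r) × (T−r²,T)). Velocity free: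
no profile convergence, no smallness constant, no sign on u or ω. (why it might fail: only through
K2⁺ (K1 is a kit over the tree zoom): an eternal space–time Type-I profile with non-increasing
similarity pressure and a singular apex would refute K2⁺ and, zoomed back, the door; none is known
(steady ones are excluded by Tsai1998, near-steady DSS by ChaeWolf2017).) [PineauVicol2026,
Tsai1998, ChaeWolf2017, SereginSverak2002]
#2 MonotonePressureProfileRigidity (crux) — MONOTONE-PRESSURE PROFILE RIGIDITY (K2⁺, the statement
not in print): let v be a profile of the door class — Type I in time (‖v(t,y)‖ ≤ C/√(−t)),
space–time Type-I decay (‖v(t,y)‖ ≤ D/(‖y‖+√(−t))), continuous on the open backward slab, satisfying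
the unit-viscosity Oseen–Duhamel identity between any two negative times, with divergence-free
slices — whose similarity Riesz pressure P(t,y) = (−t)·Q[v(t)](√(−t)y) satisfies P(e^(−σ)t, y) ≤
P(t, y) for all t < 0, σ ∈ [0,1], y (equivalently: t ↦ P(t,y) is non-increasing on t < 0, i.e. ∂ₛP ≤
0 in Leray variables; the shift form iterates to all pairs by the cell lemma rel_of_shift). Then v
is not backward-singular at the apex (0,0). Expected proof: eternal head-pressure budget against the
parabolic adjoint weight (support EternalAdjointWeight of the cell sketch) ⇒ ∫_(−∞)^(s₂−1)
‖Ω(s)‖²_(L²(B_R)) ds ≤ 2M/c ⇒ far-past small-enstrophy slice ⇒ rescale ⇒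
pineauVicol_smallVorticity_propagation + exists_cknE_le_of_core_small +
pineauVicol_regular_of_zoom_small. [difficulty: L] (why it might fail: the UNIFORM-in-s floor w ≥
c(D,R) on B_R for the parabolic adjoint weight over a time-dependent drift U(s,·)+½y is the one
estimate not on paper (tightness + e^(−3σ/2) gauge + parabolic Harnack should give it); a singular
door-class profile with ∂ₛP ≤ 0 would refute it outright.) [PineauVicol2026, Tsai1998,
NecasRuzickaSverak1996, Lieberman1996, CaffarelliKohnNirenberg1982, GigaKohn1985]
#3 LocalPointZoomSimilarityPressure (crux) — LOCAL POINT ZOOM WITH SIMILARITY-PRESSURE SLICES (K1,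
kit-sized): under the leaf's hypotheses (Clay class, local space–time Type-I bound at (x₀,T) with
constants ρ, M) and ¬ backward bounded at x₀, there are constants C, D, a profile v and scales λⱼ →
0⁺ such that v is of the door class (Type I in time C, space–time decay D, continuous on the open
slab, unit-viscosity Oseen-mild, divergence-free slices), v is backward-singular at (0,0), and for
every t < 0 and y the similarity pressure of u read at the zoom times tⱼ = T + λⱼ²t/ν and similarity
position √ν·y converges: ν⁻¹·(T−tⱼ)·Q[u(tⱼ)](x₀ + √(T−tⱼ)·√ν y) → (−t)·Q[v(t)](√(−t) y). Proof plan: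
the tree zoom localPointZoomVelGradSlices (velocity + gradient slices converge pointwise, profile
class, singular apex) + the cell's hasTypeIDecay_of_zoom (space–time decay passes to the limit) +
Riesz covariance Q[λu(x₀+λ·)](z) = λ²Q[u](x₀+λz) + near/far split of pressurePotential (near part by
local C¹ convergence and the Calderón–Zygmund representation on balls; far part ≤ C·E₀·ρ⁻³ in
physical units, killed by the factor (T−tⱼ) = λⱼ²(−t)/ν). [difficulty: M] (why it might fail: only
in the far-field bookkeeping: pressurePotential (u tⱼ) must converge slice-wise along energy-class
zooms; a far-field pressure contribution at x₀ oscillating at similarity scale would break the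
pointwise limit (the energy bound E₀·ρ⁻³·λⱼ² should exclude it — to be checked).) [PineauVicol2026,
EscauriazaSereginSverak2003, CaffarelliKohnNirenberg1982]

TWO-LAYER PLAN. Foreseen split of K2⁺ once its kit pieces land (filed then, not now):
`MonotonePressureProfileRigidity ⇐ SmallSliceOfMonotonePressure → RegularOfSmallSlices →
MonotonePressureProfileRigidity`, where SmallSliceOfMonotonePressure (L; the new mechanism: door
class ∧ shift-monotone similarity pressure ⇒ ∀ R θ > 0 ∃ t̄ < 0 with ∫_(B(0,2R√(−t̄))) |curl v(t̄)|²
≤ θ²/(4√(−t̄))) carries the adjoint-weight budget and RegularOfSmallSlices (M; door class ∧ such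
slices for all R, θ ⇒ ¬ IsBackwardSingularPoint v 0) is scaling transport (lerayOrbit_nsRescale) +
the proved Pineau–Vicol chain; the BC3 birth skeleton bc/MonotonePressureProfileRigidity_birth.lean
is exactly this split with the composition proved.

KILL CRITERIA. A refutation of K2⁺ as typed (an explicit door-class eternal profile with
non-increasing similarity pressure and singular apex) closes the route outright (`close --reason
refuted:MonotonePressureProfileRigidity`) and kills the door S17⁺ with it (the sibling S17 survives
iff the example has non-steady similarity pressure gradient). A refutation of K1 as typed can only
come from the far-field pressure bookkeeping and forces a restatement of the convergence clause
(near-field Riesz pressure of the localised velocity instead of the full pressurePotential), not a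
pivot. Proved elsewhere that moots it: a Type-I Liouville theorem for the door class (hard core
10661 TypeIliouvilleL) would make every door of the family a corollary.

NOT DECOMPOSED YET. K2⁺ is kept as ONE crux at open: its pieces (eternal head identity from
driftOp_headPressure_forced; the parabolic adjoint weight EternalAdjointWeight with unit mass,
Gaussian tail and uniform floor; the IBP budget; extraction of a far-past small slice; scaling
transport; the proved propagation chain) share the Leray-variables bookkeeping of one profile and
would shred if itemised now — they are the stubs of the BC3 skeleton and become layer-2 children by
`--split` when the first of them lands. K1's three steps (tree zoom re-export with space–time decay,
Riesz covariance, near/far convergence of pressurePotential) likewise stay inside one M-sized item.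
The supports of the sibling door S17 (PressureWindowToSlab, SteadyGradientSteadyPressure) are not
filed (not in this route's cone, BC6).

CHEAPEST FALSIFIER. The DSS sub-test: for a λ-DSS profile the similarity pressure is s-periodic, so
`∂ₛP ≤ 0` forces P steady; hence K2⁺ restricted to DSS profiles reads «Type-I λ-DSS with STEADY
similarity pressure ⇒ regular apex» — try to refute THAT against the known DSS theory (ChaeWolf2017
Thm 1.3 proves it for λ near 1 with no pressure hypothesis; forward DSS solutions of Bradshaw–Tsai
are regular-apex objects and give no counterexample). Run by the cell (ROUND-16 §4 (r1)): Landau,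
constant, Beltrami and Oseen-column eternal flows are outside the door class (unbounded slices or no
spatial decay), so no explicit family in print instantiates K2⁺'s hypotheses with a singular apex.
Second cheap check (kit, one page): the sign bookkeeping `∂ₛΠ + LΠ = −|Ω|² + ∂ₛP` from
driftOp_headPressure_forced with F = ∂ₛU — if the F-terms did not cancel the mechanism would need
∂ₛU small (= PineauVicol2026 Thm 1.9) and the route would be a variant; they cancel (memo §1(D)(i)).

NUMBERS. Door class constants: Type-I time rate C and space–time decay D of the profile (both =
M/ν-type constants inherited from the leaf's M by hasTypeIDecay_of_zoom); head bound M_Π = C_P(D) +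
½D² + ½D (PineauVicol2026 (4.1) with (2.2); tree abs_headPressure_le); propagation constants ϑ,
R₀(θ, Cu, K, K₂), T₀ of pineauVicol_smallVorticity_propagation (PineauVicol2026 Lemma 9.4, (9.17) ⇒
(9.18)); weight: unit mass, second moment ≤ R₀(D)² (Lyapunov bound d/dσ ∫|y|²w ≤ 6 +
2D(∫|y|²w)^(1/2) − ∫|y|²w), floor c(D,R) from Lieberman1996 Thm 6.27 chains of ≲ R² steps at scale
1/(16R). Sketch: r16/Sketch17.lean 464 lines, sha16 a5d0a033df28e253, farm rc 0 / 0 sorries;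
pre-render bc/ItemsGlue.lean (items + closes) rc 0.

DEFINITION REQUESTS. None — every constant exists
(Literature.Analysis.FluidPDE.{IsClassicalNSSolutionOn, IsLerayHopfOn, HasRapidSpatialDecay,
IsBackwardBoundedAt, HasTypeITimeDecay, HasTypeIDecay, IsBackwardSingularPoint, oseenDuhamel,
pressurePotential, VectorCalculus.IsDivFree}, Literature.Analysis.UnboundedOperators.heatExtension);
the similarity pressure is inlined ((T−t)·pressurePotential (u t) (x₀ + √(T−t)•y)) rather than
requested as a notion.

Novelty: Searches (2026-08-27 05:45–06:20Z, this seat; both corpora): `lit search "self-similar" pressure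
monotone regularity Navier-Stokes` and `lit search --hybrid "self-similar variables Navier-Stokes
pressure time-independent regularity criterion Bernoulli head pressure maximum principle"` →
[corpus:paper:arxiv-2607.09619 p.8 Thm 1.9, p.11 (4.1)–(4.3), p.12 Prop 5.1, p.36 (7.7), p.54
(9.17)–(9.18)] (velocity one-slice criterion, elliptic weight), [corpus:paper:arxiv-math_0604234 p.5
Thm 1.4/1.5] (Chae2007, asymptotically self-similar VELOCITY), [corpus:paper:arxiv-1610.09464 p.3
Thm 1.3/1.5] (ChaeWolf2017); `lit vsearch` ×2 («regularity if the rescaled pressure around the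
singular point converges or is non-increasing», «ancient solution Leray variables adjoint weight
Fokker–Planck positive solution lower bound») → no pressure-sided criterion; `lit galaxy search
"self-similar pressure|head pressure|Bernoulli pressure" --star all` → 0 relevant; `lit galaxy
search "discretely self-similar|backward self-similar solutions|Leray's self-similar" --star pdf` →
NRS/Tsai/Chae–Wolf-type hits only; crossref legs: doi:10.1007/pl00004460 (Miller–O'Leary–Schonbek
2001), doi:10.3934/dcds.2007.18.637 (Hou–Li 2007), doi:10.1007/s002050200199 (SereginSverak2002),
doi:10.1007/s00021-005-0198-y (Struwe 2006); OpenAlex/S2/arXiv legs rate-limited (HTTP 429) during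
the session; `ledger negatives --problem NavierStokesRegularity` (5 entries, none on pressure); tree
`rg pressurePotential|headPressure|leray  [refs: 10.1007/pl00004460, 10.3934/dcds.2007.18.637, 10.1007/s002050200199, 10.1007/s00021-005-0198-y, 2607.09619, paper:arxiv-2607.09619, paper:arxiv-math_0604234, paper:arxiv-1610.09464, doi:10.1007/pl00004460, doi:10.3934/dcds.2007.18.637, doi:10.1007/s002050200199, doi:10.1007/s00021-005-0198-y, Chae2007, ChaeWolf2017, SereginSverak2002, PineauVicol2026]

Barriers (technique_class: similarity-variables, head-pressure, adjoint-weight): - technique_class: similarity-variables, head-pressure, adjoint-weight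
- Literature.Barriers.NavierStokesRegularity.AveragedTypeIBlowup: OUTSIDE its class — the barrier
blocks Type-I EXCLUSION by averaging-insensitive arguments; this route excludes nothing
unconditionally: it asserts backward boundedness only under a fine-structure hypothesis (sign of ∂ₛP
for the exact Riesz pressure Q[u] = −Δ⁻¹∂ᵢ∂ⱼ(uᵢuⱼ) and the exact head identity ∂ₛΠ + LΠ = −|Ω|² +
∂ₛP), neither of which exists for Tao's averaged bilinear form
[corpus:Literature/Barriers/NavierStokesRegularity/AveragedTypeIBlowup.lean docstring]; the Type-I
rate itself is a hypothesis of the leaf.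
- Literature.Barriers.NavierStokesRegularity.TaoAveragedBlowup: same placement (the head-pressure
identity is specific to the true nonlinearity u·∇u = ∇½|u|² − u×ω; the averaged equation has no
Bernoulli function).
- Literature.Barriers.NavierStokesRegularity.NearOneDssTypeIExclusion: CONSISTENT, not threatened —
that entry records the proved ChaeWolf2017 Thm 1.3 / PineauVicol2026 Thm 1.9 (tree
chaeWolf2017_removing_dss_holds, pineauVicol2026_oneSlice_regularity_holds) on the NEGATIVE side;
K2⁺ is a positive-side sibling with a different hypothesis (pressure sign instead of near-one DSS /
one quiet velocity slice) and reuses their proved endgame (propagation + CKN), so it sits in the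
same method family one step beyond its printed ceiling (see BC9 in README-OPEN.md).
- Literature.Barriers.NavierStokesRegularity.LeraySelfSimilarBlo

History (route lifecycle, newest last):
- 2026-08-27T07:24:58Z · closes_target -> closes rung N0-LocalTubeDoorPressureProfile of NavierStokesRegularity: Summit.NavierStokesRegularity.NavierStokesRegularity.Theses.LocalPressureProfileDoor.Target (D-0061; not the summit Statement) (planner-director-ns-g7-0)
- 2026-08-27T18:26:42Z · CLOSED proved — proved:Summit.NavierStokesRegularity.NavierStokesRegularity.Theorems.LocalPressureProfileDoorTargetClose.target_proof (planner-director-ns-g8-0)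

sub-problem: NavierStokesRegularity · status: closed(proved) · opened planner-director-ns-g7-0 2026-08-27T07:09:31Z · rev 2 · ledger route-NavierStokesRegularity-LocalPressureProfileDoor
GENERATED by the gate from the ledger (D-0016/17). Provers cite these decls: `theorem foo : Summit.NavierStokesRegularity.NavierStokesRegularity.Theses.LocalPressureProfileDoor.<Decl> := …` in Summits/NavierStokesRegularity/NavierStokesRegularity/Theorems/<Name>.lean.
-/

namespace Summit.NavierStokesRegularity.NavierStokesRegularity.Theses.LocalPressureProfileDoor

open scoped BigOperators Topology Manifold Classical MeasureTheory ProbabilityTheory Matrix InnerProductSpace ComplexConjugate ContinuousMap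
open Filter Set Function TopologicalSpace MeasureTheory

attribute [summit_statement] _root_.NavierStokesRegularity
-- H21.Audit: the closer leaf Summit.NavierStokesRegularity.NavierStokesRegularity.Theses.LocalPressureProfileDoor.Target is an item decl of this route file — tagged summit_statement below, after its declaration

open Literature.NS

/-- item stmt-NavierStokesRegularity-20180 · crux · rank 2 · closed · proved by Summit.NavierStokesRegularity.NavierStokesRegularity.Theorems.LocalPressureProfileDoorMonotonePressureProfileRigidity.monotonePressureProfileRigidity_proof (prover) · by planner
why it might fail: the UNIFORM-in-s floor w ≥ c(D,R) on B_R for the parabolic adjoint weight over a time-dependent drift U(s,·)+½y is the one estimate not on paper (tightness + e^(−3σ/2) gauge + parabolic Harnack should give it); a singular door-class profile with ∂ₛP ≤ 0 would refute it outright.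
sources: PineauVicol2026, Tsai1998, NecasRuzickaSverak1996, Lieberman1996, CaffarelliKohnNirenberg1982, GigaKohn1985
[crux] MONOTONE-PRESSURE PROFILE RIGIDITY (K2⁺, the statement not in print): let v be a profile of
the door class — Type I in time (‖v(t,y)‖ ≤ C/√(−t)), space–time Type-I decay (‖v(t,y)‖ ≤
D/(‖y‖+√(−t))), continuous on the open backward slab, satisfying the unit-viscosity Oseen–Duhamel
identity between any two negative times, with divergence-free slices — whose similarity Riesz
pressure P(t,y) = (−t)·Q[v(t)](√(−t)y) satisfies P(e^(−σ)t, y) ≤ P(t, y) for all t < 0, σ ∈ [0,1], y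
(equivalently: t ↦ P(t,y) is non-increasing on t < 0, i.e. ∂ₛP ≤ 0 in Leray variables; the shift
form iterates to all pairs by the cell lemma rel_of_shift). Then v is not backward-singular at the
apex (0,0). Expected proof: eternal head-pressure budget against the parabolic adjoint weight
(support EternalAdjointWeight of the cell sketch) ⇒ ∫_(−∞)^(s₂−1) ‖Ω(s)‖²_(L²(B_R)) ds ≤ 2M/c ⇒
far-past small-enstrophy slice ⇒ rescale ⇒ pineauVicol_smallVorticity_propagation +
exists_cknE_le_of_core_small + pineauVicol_regular_of_zoom_small. [difficulty: L] -/
@[route_item "route-NavierStokesRegularity-LocalPressureProfileDoor", crux]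
def MonotonePressureProfileRigidity : Prop :=
  ∀ (C D : ℝ) (v : ℝ → EuclideanSpace ℝ (Fin 3) → EuclideanSpace ℝ (Fin 3)), Literature.Analysis.FluidPDE.HasTypeITimeDecay C v → Literature.Analysis.FluidPDE.HasTypeIDecay D v → ContinuousOn (Function.uncurry v) (Set.Iio (0 : ℝ) ×ˢ Set.univ) → (∀ s t : ℝ, s < t → t < 0 → ∀ x, v t x = Literature.Analysis.UnboundedOperators.heatExtension (v s) (t - s) x - Literature.Analysis.FluidPDE.oseenDuhamel 1 s v v t x) → (∀ t < 0, Literature.Analysis.FluidPDE.VectorCalculus.IsDivFree (v t)) → (∀ t < 0, ∀ σ ∈ Set.Icc (0 : ℝ) 1, ∀ y : EuclideanSpace ℝ (Fin 3), (-(Real.exp (-σ) * t)) * Literature.Analysis.FluidPDE.pressurePotential (v (Real.exp (-σ) * t)) (Real.sqrt (-(Real.exp (-σ) * t)) • y) ≤ (-t) * Literature.Analysis.FluidPDE.pressurePotential (v t) (Real.sqrt (-t) • y)) → ¬ Literature.Analysis.FluidPDE.IsBackwardSingularPoint v 0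

-- `MonotonePressureProfileRigidity` holds: proved by `Summit.NavierStokesRegularity.NavierStokesRegularity.Theorems.LocalPressureProfileDoorMonotonePressureProfileRigidity.monotonePressureProfileRigidity_proof` (its module imports this route file, so no `_holds` link can be stated here).

/-- item stmt-NavierStokesRegularity-20181 · crux · rank 3 · closed · proved by Summit.NavierStokesRegularity.NavierStokesRegularity.Theorems.LocalPressureProfileDoorLocalPointZoomSimilarityPressure.LocalPointZoomSimilarityPressure_proof (prover) · by planner
why it might fail: only in the far-field bookkeeping: pressurePotential (u tⱼ) must converge slice-wise along energy-class zooms; a far-field pressure contribution at x₀ oscillating at similarity scale would break the pointwise limit (the energy bound E₀·ρ⁻³·λⱼ² should exclude it — to be checked).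
sources: PineauVicol2026, EscauriazaSereginSverak2003, CaffarelliKohnNirenberg1982
[crux] LOCAL POINT ZOOM WITH SIMILARITY-PRESSURE SLICES (K1, kit-sized): under the leaf's hypotheses
(Clay class, local space–time Type-I bound at (x₀,T) with constants ρ, M) and ¬ backward bounded at
x₀, there are constants C, D, a profile v and scales λⱼ → 0⁺ such that v is of the door class (Type
I in time C, space–time decay D, continuous on the open slab, unit-viscosity Oseen-mild,
divergence-free slices), v is backward-singular at (0,0), and for every t < 0 and y the similarity
pressure of u read at the zoom times tⱼ = T + λⱼ²t/ν and similarity position √ν·y converges: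
ν⁻¹·(T−tⱼ)·Q[u(tⱼ)](x₀ + √(T−tⱼ)·√ν y) → (−t)·Q[v(t)](√(−t) y). Proof plan: the tree zoom
localPointZoomVelGradSlices (velocity + gradient slices converge pointwise, profile class, singular
apex) + the cell's hasTypeIDecay_of_zoom (space–time decay passes to the limit) + Riesz covariance
Q[λu(x₀+λ·)](z) = λ²Q[u](x₀+λz) + near/far split of pressurePotential (near part by local C¹
convergence and the Calderón–Zygmund representation on balls; far part ≤ C·E₀·ρ⁻³ in physical units,
killed by the factor (T−tⱼ) = λⱼ²(−t)/ν). [difficulty: M] -/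
@[route_item "route-NavierStokesRegularity-LocalPressureProfileDoor", crux]
def LocalPointZoomSimilarityPressure : Prop :=
  ∀ (ν T : ℝ), 0 < ν → 0 < T → ∀ (u : ℝ → EuclideanSpace ℝ (Fin 3) → EuclideanSpace ℝ (Fin 3)) (p : ℝ → EuclideanSpace ℝ (Fin 3) → ℝ), Literature.Analysis.FluidPDE.IsClassicalNSSolutionOn (Set.Ico 0 T) ν 0 u p → Literature.Analysis.FluidPDE.IsLerayHopfOn T ν 0 (u 0) u → Literature.Analysis.FluidPDE.HasRapidSpatialDecay (u 0) → ∀ (x₀ : EuclideanSpace ℝ (Fin 3)) (ρ M : ℝ), 0 < ρ → (∀ t ∈ Set.Ico 0 T, T - ρ ^ 2 < t → ∀ x ∈ Metric.ball x₀ ρ, ‖u t x‖ * (‖x - x₀‖ + Real.sqrt (ν * (T - t))) ≤ M) → ¬ Literature.Analysis.FluidPDE.IsBackwardBoundedAt u T x₀ → ∃ (C D : ℝ) (v : ℝ → EuclideanSpace ℝ (Fin 3) → EuclideanSpace ℝ (Fin 3)) (lam : ℕ → ℝ), (∀ j, 0 < lam j) ∧ Filter.Tendsto lam Filter.atTop (nhds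 0) ∧ Literature.Analysis.FluidPDE.HasTypeITimeDecay C v ∧ Literature.Analysis.FluidPDE.HasTypeIDecay D v ∧ ContinuousOn (Function.uncurry v) (Set.Iio (0 : ℝ) ×ˢ Set.univ) ∧ (∀ s t : ℝ, s < t → t < 0 → ∀ x, v t x = Literature.Analysis.UnboundedOperators.heatExtension (v s) (t - s) x - Literature.Analysis.FluidPDE.oseenDuhamel 1 s v v t x) ∧ (∀ t < 0, Literature.Analysis.FluidPDE.VectorCalculus.IsDivFree (v t)) ∧ Literature.Analysis.FluidPDE.IsBackwardSingularPoint v 0 ∧ ∀ t < 0, ∀ y : EuclideanSpace ℝ (Fin 3), Filter.Tendsto (fun j : ℕ => ν⁻¹ * ((T - (T + lam j ^ 2 * t / ν)) * Literature.Analysis.FluidPDE.pressurePotential (u (T + lam j ^ 2 * t / ν)) (x₀ + Real.sqrt (T - (T + lam j ^ 2 * t / ν)) • (Real.sqrt ν • y)))) Filter.atTop (nhds ((-t) * Literature.Analysis.FluidPDE.pressurePotential (v t) (Real.sqrt (-t) • y)))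

-- `LocalPointZoomSimilarityPressure` holds: proved by `Summit.NavierStokesRegularity.NavierStokesRegularity.Theorems.LocalPressureProfileDoorLocalPointZoomSimilarityPressure.LocalPointZoomSimilarityPressure_proof` (its module imports this route file, so no `_holds` link can be stated here).

/-- item stmt-NavierStokesRegularity-20179 · aside · rank 0 · closed · proved by Summit.NavierStokesRegularity.NavierStokesRegularity.Theorems.LocalPressureProfileDoorTargetClose.target_proof (prover) · by planner
why it might fail: only through K2⁺ (K1 is a kit over the tree zoom): an eternal space–time Type-I profile with non-increasing similarity pressure and a singular apex would refute K2⁺ and, zoomed back, the door; none is known (steady ones are excluded by Tsai1998, near-steady DSS by ChaeWolf2017).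
sources: PineauVicol2026, Tsai1998, ChaeWolf2017, SereginSverak2002
[target] the leaf (door S17⁺): a classical NS solution on [0,T), Leray–Hopf from a rapidly decaying
datum, locally SPACE–TIME Type I at (x₀,T) (‖u(t,x)‖(‖x−x₀‖+√(ν(T−t))) ≤ M on B(x₀,ρ) × (T−ρ²,T)),
whose similarity Riesz pressure P(t,y) = (T−t)·Q[u(t)](x₀+√(T−t)y) is ASYMPTOTICALLY NON-INCREASING
in similarity time — for every shift σ ∈ [0,1], every similarity position y and every ε > 0,
eventually as t ↑ T, P(T − e^(−σ)(T−t), y) − P(t, y) ≤ ε — is backward bounded at x₀ (u stays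
bounded on some B(x₀,r) × (T−r²,T)). Velocity free: no profile convergence, no smallness constant,
no sign on u or ω. -/
@[route_item "route-NavierStokesRegularity-LocalPressureProfileDoor"]
def Target : Prop :=
  ∀ (ν T : ℝ), 0 < ν → 0 < T → ∀ (u : ℝ → EuclideanSpace ℝ (Fin 3) → EuclideanSpace ℝ (Fin 3)) (p : ℝ → EuclideanSpace ℝ (Fin 3) → ℝ), Literature.Analysis.FluidPDE.IsClassicalNSSolutionOn (Set.Ico 0 T) ν 0 u p → Literature.Analysis.FluidPDE.IsLerayHopfOn T ν 0 (u 0) u → Literature.Analysis.FluidPDE.HasRapidSpatialDecay (u 0) → ∀ (x₀ : EuclideanSpace ℝ (Fin 3)) (ρ M : ℝ), 0 < ρ → (∀ t ∈ Set.Ico 0 T, T - ρ ^ 2 < t → ∀ x ∈ Metric.ball x₀ ρ, ‖u t x‖ * (‖x - x₀‖ + Real.sqrt (ν * (T - t))) ≤ M) → (∀ σ ∈ Set.Icc (0 : ℝ) 1, ∀ (y : EuclideanSpace ℝ (Fin 3)) (ε : ℝ), 0 < ε → ∀ᶠ t in nhdsWithin T (Set.Iio T), (T - (T - Real.exp (-σ)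 * (T - t))) * Literature.Analysis.FluidPDE.pressurePotential (u (T - Real.exp (-σ) * (T - t))) (x₀ + Real.sqrt (T - (T - Real.exp (-σ) * (T - t))) • y) - (T - t) * Literature.Analysis.FluidPDE.pressurePotential (u t) (x₀ + Real.sqrt (T - t) • y) ≤ ε) → Literature.Analysis.FluidPDE.IsBackwardBoundedAt u T x₀

-- `Target` holds: proved by `Summit.NavierStokesRegularity.NavierStokesRegularity.Theorems.LocalPressureProfileDoorTargetClose.target_proof` (its module imports this route file, so no `_holds` link can be stated here).

/-- item stmt-NavierStokesRegularity-20182 · assembly · rank 1 · closed · proved by Summit.NavierStokesRegularity.NavierStokesRegularity.Theorems.localPressureProfileDoor_assembly_proof (prover) · by planner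
sources: PineauVicol2026, Tsai1998
[assembly] LocalPointZoomSimilarityPressure → MonotonePressureProfileRigidity → the leaf (Target);
kernel-checked as `closes` (glue.lean) and as `targetMonotone_of` in r16/Sketch17.lean. -/
@[route_item "route-NavierStokesRegularity-LocalPressureProfileDoor"]
def Assembly : Prop :=
  LocalPointZoomSimilarityPressure → MonotonePressureProfileRigidity → Target

-- `Assembly` holds: proved by `Summit.NavierStokesRegularity.NavierStokesRegularity.Theorems.localPressureProfileDoor_assembly_proof` (its module imports this route file, so no `_holds` link can be stated here).

attribute [summit_statement] _root_.Summit.NavierStokesRegularity.NavierStokesRegularity.Theses.LocalPressureProfileDoor.Target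

/-! D-0027 §2.1 — DECIDING THEOREM (planner-authored via `route open/edit --closes-file`; by planner-director-ns-g7-0 2026-08-27T07:24:58Z) — ARCHIVED: route closed (proved) 2026-08-27T18:26:41Z; kept so importers keep building:
its hypotheses are this route's items and its conclusion the registered leaf `Summit.NavierStokesRegularity.NavierStokesRegularity.Theses.LocalPressureProfileDoor.Target` (rung N0-LocalTubeDoorPressureProfile, D-0061) (glue_lint), and it elaborates with this file. -/

/-- DECIDING THEOREM (D-0027 §2.1) for the rung leaf S17⁺ `LocalPressureProfileDoor.Target`. Both cruxes are
consumed: K1 zooms at a backward-unbounded point to a door-class profile `v`, singular at the apex, along which the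
similarity Riesz pressure converges; the door hypothesis (asymptotically non-increasing similarity pressure under
every shift `σ ∈ [0,1]`), read along the zoom times `tⱼ = T + λⱼ² t/ν → T⁻` and passed to the limit, makes the
profile's similarity pressure non-increasing under every such shift; K2⁺ then says the apex is not singular —
contradiction.  (Same proof as `targetMonotone_of` of the cell sketch r16/Sketch17.lean; logic + limits only.) -/
@[closes "route-NavierStokesRegularity-LocalPressureProfileDoor"] theorem closes (h₁ : LocalPointZoomSimilarityPressure) (h₂ : MonotonePressureProfileRigidity) : Target := by
  intro ν T hν hT u p hcl hLH hdec x₀ ρ M hρ hM hmono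
  by_contra hnot
  obtain ⟨C, D, v, lam, hlam, hlam0, hrate, hdecay, hcont, hmild, hdiv, hsing, hconv⟩ :=
    h₁ ν T hν hT u p hcl hLH hdec x₀ ρ M hρ hM hnot
  refine h₂ C D v hrate hdecay hcont hmild hdiv (fun t ht σ hσ y => ?_) hsing
  -- the zoom times tend to `T` from below
  have key : Filter.Tendsto (fun j : ℕ => T + lam j ^ 2 * t / ν) Filter.atTop (nhdsWithin T (Set.Iio T)) := by
    refine tendsto_nhdsWithin_iff.2 ⟨?_, Filter.Eventually.of_forall fun j => ?_⟩
    · have h1 : Filter.Tendsto (fun j : ℕ => T + lam j ^ 2 * t / ν) Filter.atTop (nhds (T + 0 ^ 2 * t / ν)) :=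
        tendsto_const_nhds.add (((hlam0.pow 2).mul_const t).div_const ν)
      simpa using h1
    · show T + lam j ^ 2 * t / ν < T
      have : lam j ^ 2 * t / ν < 0 :=
        div_neg_of_neg_of_pos (mul_neg_of_pos_of_neg (pow_pos (hlam j) 2) ht) hν
      linarith
  have ht' : Real.exp (-σ) * t < 0 := mul_neg_of_pos_of_neg (Real.exp_pos _) ht
  have h4 := (hconv (Real.exp (-σ) * t) ht' y).sub (hconv t ht y)
  refine le_of_forall_pos_le_add fun ε hε => ?_
  -- the door hypothesis along the zoom, at similarity position `√ν • y` and tolerance `ν ε`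
  have h3 := key.eventually (hmono σ hσ (Real.sqrt ν • y) (ν * ε) (by positivity))
  have h5 : ∀ᶠ j : ℕ in Filter.atTop,
      ν⁻¹ * ((T - (T + lam j ^ 2 * (Real.exp (-σ) * t) / ν)) *
          Literature.Analysis.FluidPDE.pressurePotential (u (T + lam j ^ 2 * (Real.exp (-σ) * t) / ν))
            (x₀ + Real.sqrt (T - (T + lam j ^ 2 * (Real.exp (-σ) * t) / ν)) • (Real.sqrt ν • y)))
        - ν⁻¹ * ((T - (T + lam j ^ 2 * t / ν)) *
          Literature.Analysis.FluidPDE.pressurePotential (u (T + lam j ^ 2 * t / ν))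
            (x₀ + Real.sqrt (T - (T + lam j ^ 2 * t / ν)) • (Real.sqrt ν • y))) ≤ ε := by
    filter_upwards [h3] with j hj
    have e : T - Real.exp (-σ) * (T - (T + lam j ^ 2 * t / ν)) = T + lam j ^ 2 * (Real.exp (-σ) * t) / ν := by
      ring
    rw [e] at hj
    rw [← mul_sub]
    calc ν⁻¹ * _ ≤ ν⁻¹ * (ν * ε) := mul_le_mul_of_nonneg_left hj (inv_pos.2 hν).le
      _ = ε := by field_simp
  have := le_of_tendsto h4 h5
  linarith

end Summit.NavierStokesRegularity.NavierStokesRegularity.Theses.LocalPressureProfileDoor
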